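import Mathlib
import Literature.Analysis.OperatorTheory.Enflo2023.Basic
import Literature.Analysis.OperatorTheory.Enflo2023.Vy
import Literature.Analysis.OperatorTheory.Enflo2023.Type2LargeL
import Literature.Analysis.OperatorTheory.Enflo2023.Type2Sensitivity
import Literature.Analysis.OperatorTheory.Enflo2023.Type2PrintedD2
import HarnessLib

/-!
# Enflo 2023, v2 pp.7, 20–22: the printed all-`n` quantifier of `M(L)` is HARMLESS under the manuscript's own
data constraint (referee divergence D24 — a correction of the record's reading of (47) as printed)

Source under adjudication: Per H. Enflo, *On the invariant subspace problem in Hilbert spaces*, arXiv:2305.15442 (v1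
2023, v2 2024), bib key `Enflo2023` — a CLAIMED proof of the invariant subspace problem for operators on a separable
Hilbert space.  Part of the kernel-tight typing of the manuscript by the b2b-enflo repair cell (referee seat).  It
records what FOLLOWS from the manuscript's displayed hypotheses.  NOTHING here asserts that the manuscript's main
theorem holds; no declaration concludes the invariant subspace problem for an arbitrary operator.  Value (BLOCK-2b):
theorems about typed inferences of a text — not progress on the problem.

The record's modules `Type2Sensitivity` (`printed_eq47_fails`), `Type2PrintedD2` (`printed_eq47_fails_D2`) and
`Type2ShiftModel` (`inPipeline_printed_eq47_fails`) refute (47) as printed — with `M(L)` quantified over ALL `n`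
(v2 p.21, "for every `n`") — by ONE ROGUE INDEX `n₀` at which the data vector `y'_0 + L₀ s_{n₀}` VANISHES, so that no
move lands within `0.3` of the unit vector `x₀` and `M(L₀) = ∞` for a reason unrelated to small `(εθ)`.  Those
witnesses satisfy every hypothesis EXPORTED by `Type2.eq47_of_type2` (`‖y‖ ≤ 1`, `Re⟨u₀, y⟩ ≥ 1/100`, `‖s_n‖ ≤ 2`,
weak nullity, (20)).  The referee observes that the manuscript's data carry ONE MORE constraint, used inside the
proof of `eq47_of_type2` but not exported by its statement: every `y'_n = y'_0 + s_n` is the normalised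
`y_n/‖y_n‖` chosen on p.7 with `⟨y_n/‖y_n‖, u₀⟩ ≥ 1/100` — so `‖y'_0 + s_n‖ = 1` and `Re⟨u₀, y'_0 + s_n⟩ ≥ 1/100`
for EVERY `n` (v2 p.7 L349–351 and p.20 "`y'_n = y'_0 + s_n`").  Under that constraint:

* `data_ne_zero`: `y'_0 + L s_n ≠ 0` for every `n` and every `L > 0` (if it vanished, `y'_0 + s_n = (1 − 1/L) y'_0`
  would be a unit vector with positive `u₀`-component, forcing `1 − 1/L ≥ 1`) — the rogue-index mechanism of the
  three witnesses is IMPOSSIBLE (all three have `y'_0 + s_{n₀} = −x₀`, whose `u₀`-component is `−1 < 1/100`);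
* `feasible_or_NIS`: for a NON-ZERO data vector `v`, either some `ℓ²` move lands within `0.3` of `x₀`, or the orbit
  closure of `v` is a non-trivial closed invariant subspace (it contains `v ≠ 0` and misses `x₀`);
* `movesBounded_of_movesBoundedEv`: when every index admits a move, the printed (all-`n`) `Good(L)` and the eventual
  `Good(L)` coincide (finitely many early indices are bounded by the sum of their moves' norms);
* `printed_eq47_of_data` (main): for `‖T‖ < 1`, a unit `x₀`, data with `‖y‖ ≤ 1`, `Re⟨u₀, y⟩ ≥ 1/100`, bounded
  weakly null `s_n` AND the per-index constraint, and the PRINTED threshold hypotheses of (47) (`Good(L)` for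
  `0 < L < L₀`, `¬Good(L)` for `L ≥ L₀` arbitrarily close, all-`n` quantifier), EITHER `T` has a non-trivial closed
  invariant subspace OR the conclusion of (47) holds — as printed — through the repaired theorem `Type2.eq47`.

CONSEQUENCE for the record: the misstatement located at STEPS row B30 (the `n`-quantifier of `M(L)`) is a
quantifier SLIP that the manuscript's own data constraint renders harmless — (47) as printed FOLLOWS (modulo the
invariant-subspace disjunct that the whole pipeline carries) — and the three kernel witnesses live outside that
constraint at their rogue index.  The repaired `eq47` remains the theorem the sequel uses; the type-2 branch still
stops only downstream (room claim p.20 / (27) p.13).  Dictionary: paper `⟨u, v⟩` (linear in `u`) = Mathlib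
`⟪v, u⟫_ℂ`; `Good(L)` = `Type2.MovesBounded` (all `n`) / `Type2.MovesBoundedEv` (eventually).
STATUS: all claims of this docstring kernel-checked (zero sorry); verdict on the manuscript unchanged.
-/

open scoped InnerProductSpace
open Filter Topology RCLike

namespace Literature.Analysis.OperatorTheory.Enflo2023

namespace Type2

variable {H : Type*} [NormedAddCommGroup H] [InnerProductSpace ℂ H]

/-- **A non-zero data vector admits a move into the `0.3`-ball, or `T` has a n.i.s.** (v2 pp.20–21, the tacit
alternative behind "move `y₀ + L s_n` within distance `0.3` of `x₀`"): if the orbit closure of `v ≠ 0` reaches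
`x₀`, a finitely supported `ℓ²` move gets within `3/10`; otherwise the orbit closure is a non-trivial closed
invariant subspace. [cite: Enflo2023, v2 p.20; folklore] -/
theorem feasible_or_NIS [CompleteSpace H] (T : H →L[ℂ] H) (hT : ‖T‖ < 1) (x₀ : H) {v : H} (hv : v ≠ 0) :
    HasNontrivialClosedInvariantSubspace T ∨ ∃ a : Vy.ℓ2, ‖Vy.V T hT v a - x₀‖ ≤ 3 / 10 := by
  classical
  by_cases hnc : IsNonCyclic T v
  · exact Or.inl (hasNontrivialClosedInvariantSubspace_of_isNonCyclic T hv hnc)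
  right
  have hx₀mem : x₀ ∈ orbitClosure T v := by
    have htop : orbitClosure T v = ⊤ := not_ne_iff.1 hnc
    rw [htop]; exact Submodule.mem_top
  obtain ⟨K, d, hd⟩ := exists_polyOp_near_of_mem_orbitClosure T v x₀ hx₀mem (by norm_num : (0 : ℝ) < 3 / 10)
  exact ⟨coeffSeq K d, by rw [V_coeffSeq]; exact hd⟩

/-- **Printed `Good(L)` from the eventual one, when every index admits a move**: the finitely many indices below
`n₀` are covered by the sum of the norms of one move each. [folklore] -/
theorem movesBounded_of_movesBoundedEv [CompleteSpace H] (T : H →L[ℂ] H) (hT : ‖T‖ < 1) {x₀ y : H}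
    {s : ℕ → H} {L : ℝ} (hfeas : ∀ n, ∃ a : Vy.ℓ2, ‖Vy.V T hT (y + (L : ℂ) • s n) a - x₀‖ ≤ 3 / 10)
    (h : MovesBoundedEv T hT x₀ y s L) : MovesBounded T hT x₀ y s L := by
  classical
  obtain ⟨M, n₀, hM⟩ := h
  choose b hb using hfeas
  refine ⟨M + ∑ i ∈ Finset.range n₀, ‖b i‖, fun n => ?_⟩
  have hsum_nonneg : 0 ≤ ∑ i ∈ Finset.range n₀, ‖b i‖ := Finset.sum_nonneg fun i _ => norm_nonneg _
  by_cases hn : n₀ ≤ n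
  · obtain ⟨a, ha, hfa⟩ := hM n hn
    exact ⟨a, by linarith, hfa⟩
  · push Not at hn
    refine ⟨b n, ?_, hb n⟩
    have hle : ‖b n‖ ≤ ∑ i ∈ Finset.range n₀, ‖b i‖ :=
      Finset.single_le_sum (fun i _ => norm_nonneg (b i)) (Finset.mem_range.2 hn)
    have hM0 : 0 ≤ M := (norm_nonneg _).trans (hM n₀ le_rfl).choose_spec.1
    linarith

/-- **The data vector never vanishes under the manuscript's per-index constraint** (v2 p.7 L349–351: every
`y'_n = y_n/‖y_n‖` is a unit vector with `⟨y'_n, u₀⟩ ≥ 1/100`; p.20: `y'_n = y'_0 + s_n`; and `Re⟨u₀, y'_0⟩ ≥ 1/100`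
for the weak limit): if `y + L s = 0` with `L > 0` then `y + s = (1 − 1/L) y`, whose `u₀`-component
`(1 − 1/L)·Re⟨u₀, y⟩` is `≥ 1/100 > 0` while `Re⟨u₀, y⟩ > 0`, so `1 − 1/L > 0`; but then its norm
`(1 − 1/L)‖y‖ ≤ 1 − 1/L < 1` cannot be `1`. [cite: Enflo2023, v2 pp.7, 20] -/
theorem data_ne_zero {u₀ y s : H} (hy1 : ‖y‖ ≤ 1) (hu : (1 / 100 : ℝ) ≤ re ⟪u₀, y⟫_ℂ) (hys : ‖y + s‖ = 1)
    (hangle : (1 / 100 : ℝ) ≤ re ⟪u₀, y + s⟫_ℂ) {L : ℝ} (hL : 0 < L) : y + (L : ℂ) • s ≠ 0 := by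
  intro h0
  have hL0 : (L : ℂ) ≠ 0 := by exact_mod_cast hL.ne'
  have h1 : (L : ℂ) • s = -y := by
    have := congrArg (fun z => z - y) h0
    simpa [add_sub_cancel_left] using this
  have hs : s = -(((L⁻¹ : ℝ) : ℂ) • y) := by
    have h2 : s = ((L : ℂ)⁻¹) • ((L : ℂ) • s) := by rw [smul_smul, inv_mul_cancel₀ hL0, one_smul]
    rw [h2, h1, smul_neg]
    push_cast
    rfl
  set c : ℝ := 1 - L⁻¹ with hc_def
  have hys' : y + s = (c : ℂ) • y := by
    rw [hs, hc_def]
    push_cast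
    rw [sub_smul, one_smul, sub_eq_add_neg]
  have hre : re ⟪u₀, y + s⟫_ℂ = c * re ⟪u₀, y⟫_ℂ := by
    rw [hys', inner_smul_right, RCLike.re_to_complex, RCLike.re_to_complex, Complex.re_ofReal_mul]
  have hnorm : ‖y + s‖ = |c| * ‖y‖ := by
    rw [hys', norm_smul, Complex.norm_real, Real.norm_eq_abs]
  have hcy : (1 / 100 : ℝ) ≤ c * re ⟪u₀, y⟫_ℂ := hre ▸ hangle
  have hc_pos : 0 < c := by
    by_contra hcn
    push Not at hcn
    nlinarith
  have hc_lt : c < 1 := by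
    rw [hc_def]
    have : 0 < L⁻¹ := inv_pos.2 hL
    linarith
  rw [hnorm, abs_of_pos hc_pos] at hys
  nlinarith

/-- **(47) as printed follows under the manuscript's data constraint** (v2 pp.20–22; STEPS row B30 re-read):
with the PRINTED all-`n` `Good(L)` = `MovesBounded` in both threshold hypotheses, data with `‖y‖ ≤ 1`,
`Re⟨u₀, y⟩ ≥ 1/100`, `‖s_n‖ ≤ D`, weakly null `s_n`, and the per-index constraint `‖y + s_n‖ = 1`,
`Re⟨u₀, y + s_n⟩ ≥ 1/100` (the normalised `y_n` of p.7): EITHER `T` has a non-trivial closed invariant subspace,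
OR for every `c, δ > 0` and `N` there are `n ≥ N`, a radius `r ∈ [3/10, 3/10 + δ]` and a minimal move of
`y + L₀ s_n` into the `r`-ball at `x₀` with `0 ≤ (εθ) < c` — the printed conclusion of (47), obtained through the
repaired `eq47` because the printed and the eventual thresholds coincide once no data vector vanishes.
[cite: Enflo2023, v2 p.22, (47); as printed, under the p.7 constraint] -/
theorem printed_eq47_of_data [CompleteSpace H] (T : H →L[ℂ] H) (hT : ‖T‖ < 1) {u₀ x₀ y : H} {s : ℕ → H}
    {D L₀ : ℝ} (hx₀ : ‖x₀‖ = 1) (hy1 : ‖y‖ ≤ 1) (hu : (1 / 100 : ℝ) ≤ re ⟪u₀, y⟫_ℂ)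
    (hunit : ∀ n, ‖y + s n‖ = 1) (hang : ∀ n, (1 / 100 : ℝ) ≤ re ⟪u₀, y + s n⟫_ℂ)
    (hsD : ∀ n, ‖s n‖ ≤ D) (hs : ∀ v : H, Tendsto (fun n => ⟪v, s n⟫_ℂ) atTop (𝓝 0))
    (hL₀ : 0 < L₀) (hbelow : ∀ L, 0 < L → L < L₀ → MovesBounded T hT x₀ y s L)
    (habove : ∀ δ > 0, ∃ L, L₀ ≤ L ∧ L < L₀ + δ ∧ 0 < L ∧ ¬ MovesBounded T hT x₀ y s L) :
    HasNontrivialClosedInvariantSubspace T ∨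
      ∀ c > 0, ∀ δ > 0, ∀ N : ℕ, ∃ n, N ≤ n ∧ ∃ r : ℝ, 3 / 10 ≤ r ∧ r ≤ 3 / 10 + δ ∧ ∃ a : Vy.ℓ2,
        IsMinimal (Vy.V T hT (y + (L₀ : ℂ) • s n)) x₀ r a ∧
        0 ≤ re ⟪x₀ - Vy.V T hT (y + (L₀ : ℂ) • s n) a, Vy.V T hT (y + (L₀ : ℂ) • s n) a⟫_ℂ ∧
        re ⟪x₀ - Vy.V T hT (y + (L₀ : ℂ) • s n) a, Vy.V T hT (y + (L₀ : ℂ) • s n) a⟫_ℂ < c := by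
  by_cases hnis : HasNontrivialClosedInvariantSubspace T
  · exact Or.inl hnis
  right
  -- every index admits a move, for every `L > 0`
  have hfeas : ∀ L : ℝ, 0 < L → ∀ n, ∃ a : Vy.ℓ2, ‖Vy.V T hT (y + (L : ℂ) • s n) a - x₀‖ ≤ 3 / 10 := by
    intro L hL n
    rcases feasible_or_NIS T hT x₀ (data_ne_zero hy1 hu (hunit n) (hang n) hL) with h | h
    · exact absurd h hnis
    · exact h
  have hbelow' : ∀ L, 0 < L → L < L₀ → MovesBoundedEv T hT x₀ y s L :=
    fun L hL hLL => movesBoundedEv_of_movesBounded T hT (hbelow L hL hLL)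
  have habove' : ∀ δ > 0, ∃ L, L₀ ≤ L ∧ L < L₀ + δ ∧ 0 < L ∧ ¬ MovesBoundedEv T hT x₀ y s L := by
    intro δ hδ
    obtain ⟨L, h1, h2, h3, h4⟩ := habove δ hδ
    exact ⟨L, h1, h2, h3, fun hev => h4 (movesBounded_of_movesBoundedEv T hT (hfeas L h3) hev)⟩
  intro c hc δ hδ N
  exact eq47 T hT hx₀ hsD hs hL₀ hbelow' habove' hc hδ N

/-- **The `D = 2` witness violates the per-index constraint at its rogue index**: `y'_0 = y + s'_0 = −x₀` for the
data of `Type2PrintedD2` (and of `Type2ShiftModel`, which instantiates them at `x₀ = e_0`), so `Re⟨u₀, y'_0⟩ = −1`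
for `u₀ = x₀` — outside the manuscript's `⟨y_n/‖y_n‖, u₀⟩ ≥ 1/100` (v2 p.7); the rogue-index mechanism of
`printed_eq47_fails`, `printed_eq47_fails_D2`, `inPipeline_printed_eq47_fails` is exactly what `data_ne_zero`
excludes. [cite: Enflo2023, v2 p.7] -/
theorem exY2_add_exS2_zero (x₀ : H) (e : ℕ → H) : exY2 x₀ + exS2 x₀ e 0 = -x₀ := by
  rw [exS2_zero, exY2, ← add_smul]
  have : (((12 / 13 : ℝ) : ℂ) + ((-(25 / 13) : ℝ) : ℂ)) = -1 := by push_cast; norm_num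
  rw [this, neg_one_smul]

/-- `Re⟨x₀, y'_0⟩ = −1 < 1/100` for the witness with `u₀ = x₀` unit. [cite: Enflo2023, v2 p.7] -/
theorem re_inner_exY2_add_exS2_zero {x₀ : H} (hx₀ : ‖x₀‖ = 1) (e : ℕ → H) :
    re ⟪x₀, exY2 x₀ + exS2 x₀ e 0⟫_ℂ = -1 := by
  rw [exY2_add_exS2_zero, inner_neg_right, map_neg, inner_self_eq_norm_sq_to_K, hx₀]
  simp

end Type2

end Literature.Analysis.OperatorTheory.Enflo2023
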